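import Summits.Ventures.CertifiedManyBodySolver.Downfold.RouterWordScoreV8PreregG15

/-!
# The typing lever, the one-band D3 margin, and the cur-1 g31 drafts: score-2's pre-registered router-word readings
# of 2026-08-28 21:1xZ (PREREG §E, by reference to Y87) as kernel facts of the §4.2 score

Venture CertifiedManyBodySolver, cell `pub/hubbard-downfold`, seat hubbard-downfold-score-2 (g16); namespace
`Summit.Ventures.CertifiedManyBodySolver.Downfold.RouterScore` (REUSES `outcome`, `score`, `Head`, `Outcome`, the property sheet
of `RouterWordScore.lean` and §1 of `RouterWordScoreV8PreregG15.lean`; the only new definitions are the three-line D3 reading of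
§2). Context: the curator's successor shelf (validation/cur-1/v8-candidates-drafts-g31/, 2026-08-28 20:26Z … 20:57Z) holds nine
NEW validation-set v8 candidates with typed expected router words — V8-213 Mo₃Sb₇ and V8-214 SrPt₂As₂ («EPH | EPH+UND:STRUCT»),
V8-215 ZnNNi₃ («EPH | UND:MULTIORB+EPH»), and six «EPH»-only rows V8-216 LaOs₄As₁₂ · V8-217 LaRu₄P₁₂ · V8-218 LaFe₄P₁₂ ·
V8-219 ZrRuAs · V8-220 HfRuP · V8-221 Mo₃P. The curator's letter (d) asks score-2, for LaFe₄P₁₂ and Mo₃P, whether a d-manifold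
head riding with EPH («UND:MULTIORB(k=5; J_H)+EPH» / «UND:MIXED(…)+EPH») is AGREE-class or PARTIAL-class. score-2's registered
answer (python twin `validation/score/router/router_score.py` `outcome()`, sha16 e9ae75b6ad88f8c5, every case checked there
first): PARTIAL AS TYPED, AGREE only if the lead TYPES the compound word before the print — §1 is that answer as a theorem.

* §1 THE TYPING LEVER (general, any token type): if the print's leading head `p` is non-structural and the expectation is
  extended by the alternative `p :: secs` whose tokens all occur in the print, the cell scores `AGREE`
  (`outcome_eq_agree_of_self_typed`); combined with G15 §1 (`outcome_ne_agree_of_primary_untyped`): the SAME print is never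
  `AGREE` while `p` is untyped and `AGREE` once `p :: secs` is typed (`typing_lever`) — the decision is the typist's, and it
  is made before the print or not at all.
* §2 THE ONE-BAND D3 MARGIN (box of record #255, α-BiPd M375, 2026-08-28 20:59Z): D3 fires iff SOME crossing band carries a
  d-share ≥ θ_d; on the record's six Pd-4d shares (34, 34, 36, 34, 30, 32 hundredths) D3 fires at θ_d = 35 on EXACTLY ONE band
  and the cell's score against the typed «EPH» is a step function of θ_d that flips at 36 (`bipd_cell_decided_by_d3_margin`):
  the lead's «the hinge is the D3 margin itself» as a theorem (FRAGILE-class by construction; margin 1 ≤ 5 hundredths).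
* §3 the nine draft rows' tables under their three typings; §4 the two prints of 20:59Z against their registrations
  (RbBi₂ «EPH» ⇒ AGREE; α-BiPd «UND:MULTIORB(k=5; J_H)+EPH» ⇒ PARTIAL, a shape pre-named 2026-08-28 12:1xZ).

WHAT THIS IS NOT: not a word, not a prediction that any material prints these words, not a score of record (v8 rows are
written once at the lead's «v8 CLOSE», never pooled with the calibration R), not the router's D3/R3c rule (§2 reads ONE located
statistic of one box; the r_man ≥ θ_c3 leg of R3c held at both hull ends there and is taken as read), and not physics.
Material names appear only in docstrings; descriptor payloads annotate a head and do not change its token.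
-/

namespace Summit.Ventures.CertifiedManyBodySolver.Downfold

namespace RouterScore

/-! ## §1 The typing lever -/

section general

variable {α : Type*} [DecidableEq α] (structural : α → Bool)

/-- A print fully matches its own compound word: `p :: secs` is fully matched by any print led by `p` that carries every
token of `secs`. [folklore] -/
theorem fullMatch_self_typed {p : α} {tl secs : List α} (hsub : ∀ t ∈ secs, t ∈ p :: tl) :
    fullMatch (p :: tl) (p :: secs) = true := by
  simp only [fullMatch, covers, List.head?_cons, Bool.and_eq_true, decide_eq_true_eq, List.all_eq_true]
  refine ⟨trivial, fun t ht => ?_⟩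
  rcases List.mem_cons.1 ht with rfl | h
  · exact List.mem_cons.2 (Or.inl rfl)
  · exact hsub t h

/-- THE TYPING LEVER (sufficiency). If the leading head `p` of the print is non-structural and the typed expectation is
extended by the compound alternative `p :: secs` whose tokens all occur in the print, the cell scores `AGREE` — whatever the
other alternatives are and whatever else rides in the print. (The curator's letter (d)(i): a d-head print «UND:MULTIORB(…)+EPH»
on an «EPH»-typed row turns AGREE-class exactly when «UND:MULTIORB+EPH» is typed.) [folklore] -/
theorem outcome_eq_agree_of_self_typed {p : α} {tl secs : List α} (alts : List (List α))
    (hp : structural p = false) (hsub : ∀ t ∈ secs, t ∈ p :: tl) :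
    outcome structural (p :: tl) (alts ++ [p :: secs]) = .AGREE := by
  rw [outcome_eq_agree_iff structural (by simp) (by simp [hp])]
  exact ⟨p :: secs, List.mem_append_right _ (List.mem_singleton_self _), fullMatch_self_typed hsub⟩

/-- THE TYPING LEVER (both arms). With `p` non-structural and NOT the primary of any typed alternative, the print `p :: tl`
is never `AGREE` (G15 §1, the untyped-primary ceiling); typing `p :: secs` (tokens drawn from the print) makes the same print
`AGREE`. The decision between the two arms is the typist's and precedes the print. [folklore] -/
theorem typing_lever {p : α} {tl secs : List α} {alts : List (List α)} (hp : structural p = false)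
    (huntyped : ∀ a ∈ alts, a.head? ≠ some p) (hsub : ∀ t ∈ secs, t ∈ p :: tl) :
    outcome structural (p :: tl) alts ≠ .AGREE ∧ outcome structural (p :: tl) (alts ++ [p :: secs]) = .AGREE :=
  ⟨outcome_ne_agree_of_primary_untyped structural huntyped, outcome_eq_agree_of_self_typed structural alts hp hsub⟩

end general

open Head

/-- The lever on the router's token type, in the shape the curator asked about (LaFe₄P₁₂ V8-218 / Mo₃P V8-221, typed «EPH»
only AS STAGED): the d-head print «UND:MULTIORB(k=5; J_H)+EPH» ⇒ PARTIAL as typed, ⇒ AGREE once «UND:MULTIORB+EPH» is typed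
(the M146 MgCNi₃ / M398 NiBi₃ grammar); the straddle print «UND:MIXED(…)+EPH» likewise with «UND:MIXED+EPH»; and typing one
compound word does not rescue the OTHER head (straddle print on «EPH | UND:MULTIORB+EPH» stays PARTIAL). [folklore] -/
theorem lever_dhead_on_eph_row :
    score [undMultiorb, eph] [[eph]] = .PARTIAL ∧ score [undMultiorb, eph] ([[eph]] ++ [[undMultiorb, eph]]) = .AGREE
    ∧ score [undMixed, eph] [[eph]] = .PARTIAL ∧ score [undMixed, eph] ([[eph]] ++ [[undMixed, eph]]) = .AGREE
    ∧ score [undMixed, eph] ([[eph]] ++ [[undMultiorb, eph]]) = .PARTIAL := by decide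

/-! ## §2 The one-band D3 margin (box of record #255, α-BiPd M375 @0) -/

/-- D3 as the router reads it on a list of crossing-band d-shares (hundredths): it fires iff SOME band's share reaches the
threshold θ_d. [folklore] -/
def d3Fires (θ : ℕ) (shares : List ℕ) : Bool := shares.any fun s => decide (θ ≤ s)

/-- D3 fires iff some listed share reaches θ_d. [folklore] -/
theorem d3Fires_iff (θ : ℕ) (shares : List ℕ) : d3Fires θ shares = true ↔ ∃ s ∈ shares, θ ≤ s := by
  simp [d3Fires, List.any_eq_true]

/-- Lowering the threshold keeps D3 firing (antitone in θ_d). [folklore] -/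
theorem d3Fires_of_le {θ θ' : ℕ} {shares : List ℕ} (h : θ' ≤ θ) (hf : d3Fires θ shares = true) :
    d3Fires θ' shares = true := by
  rw [d3Fires_iff] at hf ⊢
  obtain ⟨s, hs, hle⟩ := hf
  exact ⟨s, hs, Nat.le_trans h hle⟩

/-- The six crossing bands' Pd-4d eight-site summed shares of box #255 (α-BiPd, QE-7.5 record leg j317525; identical to 2 dp on
the 7.0 method-hull member), in hundredths: 0.34 / 0.34 / 0.36 / 0.34 / 0.30 / 0.32. [folklore] -/
def bipdSharesPct : List ℕ := [34, 34, 36, 34, 30, 32]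

/-- At the router's θ_d = 0.35 D3 fires on box #255, and on EXACTLY ONE of the six bands (the 0.36 band; three sit at 0.34 =
θ_d − 0.01). [folklore] -/
theorem bipd_d3_fires_on_one_band :
    d3Fires 35 bipdSharesPct = true ∧ (bipdSharesPct.filter fun s => decide (35 ≤ s)) = [36] := by decide

/-- On box #255 D3 fires iff θ_d ≤ 0.36: the whole D3 reading of this material is the position of ONE band's share relative to
the threshold. [folklore] -/
theorem bipd_d3_iff (θ : ℕ) : d3Fires θ bipdSharesPct = true ↔ θ ≤ 36 := by
  simp [d3Fires, bipdSharesPct]; omega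

/-- The word of box #255 as a function of θ_d, everything else of the record held fixed (R3c's r_man = [0.66, 1.63] ≥ θ_c3 at
both hull ends is taken as read, so a firing D3 heads the word with «UND:MULTIORB(k=5; J_H)» and EPH rides; a silent D3 leaves
«EPH»). [folklore] -/
def bipdWord (θ : ℕ) : List Head := if d3Fires θ bipdSharesPct then [undMultiorb, eph] else [eph]

/-- «THE HINGE IS THE D3 MARGIN ITSELF» (lead, boxes line of 2026-08-28T21:00:38Z) as a theorem: against the typed «EPH» the
cell's score is a STEP FUNCTION of θ_d flipping at 0.36 — PARTIAL for every θ_d ≤ 0.36 (the router's 0.35 included), AGREE for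
every θ_d ≥ 0.37. A 0.01 re-reading of one band's share (Löwdin σ_FS, tie convention, per-atom vs summed sublattice — the items
named for ref-1's audit) moves the cell between the two values; nothing else in the score does. [folklore] -/
theorem bipd_cell_decided_by_d3_margin (θ : ℕ) :
    score (bipdWord θ) [[eph]] = if θ ≤ 36 then .PARTIAL else .AGREE := by
  unfold bipdWord
  by_cases h : θ ≤ 36
  · rw [if_pos ((bipd_d3_iff θ).2 h), if_pos h]; decide
  · have hf : d3Fires θ bipdSharesPct = false := by
      cases hv : d3Fires θ bipdSharesPct with
      | false => rfl
      | true => exact absurd ((bipd_d3_iff θ).1 hv) h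
    rw [hf, if_neg h]; decide

/-- The record's instance: at θ_d = 0.35 the cell is PARTIAL with D3 margin +0.01 ≤ 0.05 (the START-HERE (11)(b)(ii) band ⇒
FRAGILE-class census entry by construction); one hundredth higher on the deciding band's side (θ_d = 0.37) it would be AGREE.
[folklore] -/
theorem bipd_record_instance :
    score (bipdWord 35) [[eph]] = .PARTIAL ∧ score (bipdWord 37) [[eph]] = .AGREE ∧ 36 - 35 ≤ 5 := by
  refine ⟨?_, ?_, by decide⟩
  · rw [bipd_cell_decided_by_d3_margin]; decide
  · rw [bipd_cell_decided_by_d3_margin]; decide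

/-! ## §3 The nine cur-1 g31 draft rows (PREREG §E 2026-08-28T21:10Z) -/

/-- The six «EPH»-only rows — LaOs₄As₁₂ (V8-216), LaRu₄P₁₂ (V8-217), LaFe₄P₁₂ (V8-218), ZrRuAs (V8-219), HfRuP (V8-220), Mo₃P
(V8-221): «EPH», «EPH+SA», «EPH+UND:STRUCT(…)» ⇒ AGREE; PRE-NAMED at-risk shapes — the d-manifold R3c straddle «UND:MIXED(…)+EPH»
(Mo-4d: the Mo₃Al₂C print; Ru/Rh-4d: RuB₂ / SrRh₂ / RhGe; Os-5d: OsB₂; Zr/Hf: the v3 Zr readings) ⇒ PARTIAL; the d-head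
«UND:MULTIORB(k=5; J_H)+EPH» (Fe-3d on LaFe₄P₁₂; the pnictide reader) ⇒ PARTIAL; a moment-straddle composite
«UND:MIXED(m …)+UND:MULTIORB+EPH» ⇒ PARTIAL; the f⁰-La comparator head leading «UND:HF-candidate(…)+UND:MIXED+EPH» ⇒ PARTIAL;
«UND:MIXED» / «UND:MULTIORB» alone ⇒ DISAGREE; an «UND:STRUCT…» primary ⇒ ABSTAIN_structure. [folklore] -/
theorem v8g16_eph_only_rows :
    score [eph] [[eph]] = .AGREE ∧ score [eph, sa] [[eph]] = .AGREE ∧ score [eph, undStruct] [[eph]] = .AGREE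
    ∧ score [undMixed, eph] [[eph]] = .PARTIAL ∧ score [undMultiorb, eph] [[eph]] = .PARTIAL
    ∧ score [undMixed, undMultiorb, eph] [[eph]] = .PARTIAL ∧ score [other 1, undMixed, eph] [[eph]] = .PARTIAL
    ∧ score [undMixed] [[eph]] = .DISAGREE ∧ score [undMultiorb] [[eph]] = .DISAGREE
    ∧ score [undStruct, eph] [[eph]] = .ABSTAIN_structure := by decide

/-- By G15 §1 no straddle-led or d-head-led print can AGREE on an «EPH»-only row, whatever rides. [folklore] -/
theorem v8g16_eph_only_heads_never_agree (tl : List Head) :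
    score (undMixed :: tl) [[eph]] ≠ .AGREE ∧ score (undMultiorb :: tl) [[eph]] ≠ .AGREE :=
  ⟨outcome_ne_agree_of_primary_untyped Head.structural (by decide),
   outcome_ne_agree_of_primary_untyped Head.structural (by decide)⟩

/-- The two located-instability rows typed «EPH | EPH+UND:STRUCT» — Mo₃Sb₇ (V8-213, typed on the 4-K tetragonal cell) and
SrPt₂As₂ (V8-214, structure proxy (i)): «EPH(+SA)» and «EPH+UND:STRUCT(…)» ⇒ AGREE; the Mo-4d / Pt-5d straddle «UND:MIXED(…)+EPH»
⇒ PARTIAL AS TYPED and ⇒ AGREE if the curator's alternative second word «UND:MIXED+EPH» is adopted before the print (three-word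
typing); «UND:MULTIORB(k; J_H)+EPH» ⇒ PARTIAL; «UND:MIXED» alone ⇒ DISAGREE; an «UND:STRUCT(…)» PRIMARY ⇒ ABSTAIN_structure
(UND:STRUCT is typed only as a secondary, so the gate fires). [folklore] -/
theorem v8g16_located_instability_rows :
    score [eph] [[eph], [eph, undStruct]] = .AGREE ∧ score [eph, undStruct] [[eph], [eph, undStruct]] = .AGREE
    ∧ score [eph, sa] [[eph], [eph, undStruct]] = .AGREE
    ∧ score [undMixed, eph] [[eph], [eph, undStruct]] = .PARTIAL
    ∧ score [undMixed, eph] ([[eph], [eph, undStruct]] ++ [[undMixed, eph]]) = .AGREE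
    ∧ score [undMultiorb, eph] [[eph], [eph, undStruct]] = .PARTIAL
    ∧ score [undMixed] [[eph], [eph, undStruct]] = .DISAGREE
    ∧ score [undStruct, eph] [[eph], [eph, undStruct]] = .ABSTAIN_structure
    ∧ score [undStruct, eph] [[eph], [undStruct, eph]] = .AGREE := by decide

/-- ZnNNi₃ (V8-215), typed «EPH | UND:MULTIORB+EPH» = the MgCNi₃ M146 / NiBi₃ M398 Ni-3d grammar: «EPH(+SA)» and
«UND:MULTIORB(k=5; J_H)+EPH» ⇒ AGREE; PRE-NAMED at-risk shape = EXACTLY the print of its carbon twin M146 MgCNi₃ @0,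
«UND:MIXED+EPH» ⇒ PARTIAL (UND:MIXED is not a typed primary; EPH rides) — and never AGREE whatever rides (G15 §1);
«UND:MULTIORB» without EPH ⇒ PARTIAL; the moment composite «UND:MIXED(m …)+UND:MULTIORB+EPH» ⇒ PARTIAL; «UND:MIXED» alone ⇒
DISAGREE; an «UND:STRUCT…» primary ⇒ ABSTAIN_structure. [folklore] -/
theorem v8g16_znnni3 :
    score [eph] [[eph], [undMultiorb, eph]] = .AGREE ∧ score [undMultiorb, eph] [[eph], [undMultiorb, eph]] = .AGREE
    ∧ score [undMixed, eph] [[eph], [undMultiorb, eph]] = .PARTIAL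
    ∧ score [undMultiorb] [[eph], [undMultiorb, eph]] = .PARTIAL
    ∧ score [undMixed, undMultiorb, eph] [[eph], [undMultiorb, eph]] = .PARTIAL
    ∧ score [undMixed] [[eph], [undMultiorb, eph]] = .DISAGREE
    ∧ score [undStruct, eph] [[eph], [undMultiorb, eph]] = .ABSTAIN_structure := by decide

/-- The MgCNi₃-shape print can never AGREE on the ZnNNi₃ row as typed, whatever rides (G15 §1 instance). [folklore] -/
theorem v8g16_znnni3_twin_print_never_agree (tl : List Head) :
    score (undMixed :: tl) [[eph], [undMultiorb, eph]] ≠ .AGREE :=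
  outcome_ne_agree_of_primary_untyped Head.structural (by decide)

/-! ## §4 The prints of 20:59Z against their registrations -/

/-- Boxes of record #254 / #255 (2026-08-28T20:59Z): M389 RbBi₂ @0 «EPH» on an «EPH»-typed row ⇒ AGREE (registered 12:1xZ,
D3 silent on an sp bismuthide); M375 α-BiPd @0 «UND:MULTIORB(k=5; J_H)+EPH» on an «EPH»-typed row ⇒ PARTIAL = the shape listed
in the 12:1xZ registration («UND:MULTIORB(k; J_H)+EPH ⇒ PARTIAL» beside the Pd-4d straddle) — the MO-PRED tally's 12th and 13th
counted rows after the 1.8 cut. [folklore] -/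
theorem v8g16_prints_2059 : score [eph] [[eph]] = .AGREE ∧ score [undMultiorb, eph] [[eph]] = .PARTIAL := by decide

/-! ## §5 (appended 2026-08-28T22:3xZ) The lead's TWO-LEG pre-typing rule of the same evening, composed with the lever

Between 21:15Z and 22:02Z the cell lead ruled, row by row and BEFORE any print, when the d-manifold straddle «UND:MIXED+EPH» is
PRE-TYPED as an alternative on an «EPH»-class row (rulings R-pm Mo₃P · R-pn Mo₃Sb₇: typed; R-po LaOs₄As₁₂ · R-pp ZnNNi₃ · R-pt YPt₂Si₂:
not typed): it is typed iff BOTH legs hold — leg 1 = a same-d-shell house precedent printed the straddle, leg 2 = a LOCATED correlation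
number in the row's own text (the START-HERE v0.4.27 docket (i)–(v)). The composition with §1 is a two-line truth table: on a straddle
print the cell is AGREE iff leg 1 ∧ leg 2, PARTIAL otherwise; on an «EPH» print it is AGREE whatever the legs. So the rule can only
RAISE a straddle cell and never touches any other cell — the by-construction content of tonight's five rulings. -/

/-- The typed expectation of an «EPH»-class row under the lead's two-leg rule: «EPH» always; «UND:MIXED+EPH» appended iff both legs
hold (R-pm / R-pn typed it; R-po / R-pp / R-pt did not). [folklore] -/
def twoLegTyped (leg1 leg2 : Bool) : List (List Head) :=
  if leg1 && leg2 then [[eph], [undMixed, eph]] else [[eph]]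

/-- THE TWO-LEG TABLE. On the straddle print «UND:MIXED(…)+EPH» the cell is AGREE iff both legs hold and PARTIAL otherwise; on the
plain «EPH(+SA)» print it is AGREE for every leg assignment. (Mo₃P / Mo₃Sb₇: legs ✓✓ ⇒ a straddle print reads AGREE; LaOs₄As₁₂ /
ZnNNi₃-class / YPt₂Si₂ / the Pt-122 drafts: leg 2 ✗ ⇒ a straddle print reads PARTIAL «by construction», the lead's words.) [folklore] -/
theorem two_leg_table (leg1 leg2 : Bool) :
    score [undMixed, eph] (twoLegTyped leg1 leg2) = (if leg1 && leg2 then .AGREE else .PARTIAL)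
    ∧ score [eph] (twoLegTyped leg1 leg2) = .AGREE ∧ score [eph, sa] (twoLegTyped leg1 leg2) = .AGREE := by
  unfold twoLegTyped; cases leg1 <;> cases leg2 <;> decide

/-- The rule only RAISES: for every leg assignment the straddle cell under the two-leg typing is never worse than under «EPH» alone
(PARTIAL ↦ PARTIAL or AGREE), and the «EPH» cell is unchanged. Equivalently: pre-typing cannot manufacture a non-AGREE cell.
[folklore] -/
theorem two_leg_only_raises (leg1 leg2 : Bool) :
    (score [undMixed, eph] (twoLegTyped leg1 leg2) = .AGREE ∨
      score [undMixed, eph] (twoLegTyped leg1 leg2) = score [undMixed, eph] [[eph]])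
    ∧ score [eph] (twoLegTyped leg1 leg2) = score [eph] [[eph]] := by
  unfold twoLegTyped; cases leg1 <;> cases leg2 <;> decide

/-- What the rule does NOT pre-accept stays where it was: under the two-leg typing with both legs met, the d-head print
«UND:MULTIORB(k; J_H)+EPH» is still PARTIAL and «UND:MULTIORB» alone still DISAGREE (the lead's «MULTIORB / HF / no-EPH NOT
pre-accepted»), while the moment composite led by the SAME token UND:MIXED reads AGREE — the payload-blindness noted on the bus before
any Mo₃P / Mo₃Sb₇ print (§4.2 scores tokens, not payloads). [folklore] -/
theorem two_leg_not_preaccepted :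
    score [undMultiorb, eph] (twoLegTyped true true) = .PARTIAL ∧ score [undMultiorb] (twoLegTyped true true) = .DISAGREE
    ∧ score [undMixed] (twoLegTyped true true) = .PARTIAL
    ∧ score [undMixed, undMultiorb, eph] (twoLegTyped true true) = .AGREE := by
  unfold twoLegTyped; decide

/-! ## §6 (appended 2026-08-28T23:1xZ) The D3 step in general, and the evening's two FRAGILE rows on either side of θ_d

Box #258 (M391 ScGa₃ @0, 22:42Z) printed «EPH» ⇒ AGREE with the flag FRAGILE(D3 −0.009 on band 25): its deciding Sc-3d share sits
0.009 BELOW θ_d = 0.35, where box #255 (α-BiPd, §2) sat 0.008 ABOVE it. §2's step function is stated here for ANY share list and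
either non-typed d-head, and the pair is pinned: the two boxes print different D3 outcomes iff θ_d lies in the 17-thousandths window
[0.342, 0.358] that contains the router's 0.350 — outside it they print the same class. Shares in thousandths in this section. -/

/-- The word of an «EPH»-class row as a function of θ_d when a firing D3 heads it with the d-head `h` (the R3c straddle «UND:MIXED»
or the manifold head «UND:MULTIORB», by the box's own r_man / k reading, taken as read) and a silent D3 leaves «EPH». [folklore] -/
def d3Word (h : Head) (θ : ℕ) (shares : List ℕ) : List Head := if d3Fires θ shares then [h, eph] else [eph]

/-- THE D3 STEP, GENERAL FORM: against the typed «EPH», for either d-head and ANY list of crossing-band shares, the cell is PARTIAL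
exactly when D3 fires and AGREE exactly when it is silent — the score of such a row is a function of ONE bit, «does some share reach
θ_d». (§2's `bipd_cell_decided_by_d3_margin` is the instance h = UND:MULTIORB, shares = box #255.) [folklore] -/
theorem d3Word_cell (h : Head) (hh : h = undMixed ∨ h = undMultiorb) (θ : ℕ) (shares : List ℕ) :
    score (d3Word h θ shares) [[eph]] = (if d3Fires θ shares then .PARTIAL else .AGREE) := by
  unfold d3Word
  generalize d3Fires θ shares = b
  rcases hh with rfl | rfl <;> cases b <;> decide

/-- With the d-head typed as an alternative («EPH | h+EPH», the two-leg-typed rows of §5) the same word is AGREE whether or not D3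
fires — on those rows the D3 margin stops being a score hinge. [folklore] -/
theorem d3Word_cell_typed (h : Head) (hh : h = undMixed ∨ h = undMultiorb) (θ : ℕ) (shares : List ℕ) :
    score (d3Word h θ shares) [[eph], [h, eph]] = .AGREE := by
  unfold d3Word
  generalize d3Fires θ shares = b
  rcases hh with rfl | rfl <;> cases b <;> decide

/-- Deciding shares of the evening's two FRAGILE rows, in thousandths: box #255 α-BiPd band 131 Pd-4d 0.358 (ref-1 V61: 0.3582);
box #258 ScGa₃ band 25 Sc-3d 0.341 (lead: margin −0.009). [folklore] -/
def bipdDecidingPm : ℕ := 358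
/-- see `bipdDecidingPm`. [folklore] -/
def scga3DecidingPm : ℕ := 341

/-- At the router's θ_d = 0.350 the two rows print opposite D3 bits — #255 fires (⇒ d-head ⇒ PARTIAL), #258 is silent (⇒ «EPH» ⇒
AGREE) — and they print DIFFERENT bits iff 0.342 ≤ θ_d ≤ 0.358: a window 17 thousandths wide; for every θ_d outside it the two
boxes land in the same score class. Neither word is wrong; both are one hundredth from the other class (FRAGILE by construction, the
(13)(ab) census flag), and no choice of θ_d puts both more than 0.009 from the threshold. [folklore] -/
theorem fragile_pair_window (θ : ℕ) :
    (d3Fires 350 [bipdDecidingPm] = true ∧ d3Fires 350 [scga3DecidingPm] = false)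
    ∧ ((d3Fires θ [bipdDecidingPm] ≠ d3Fires θ [scga3DecidingPm]) ↔ (342 ≤ θ ∧ θ ≤ 358)) := by
  refine ⟨by decide, ?_⟩
  simp [d3Fires, bipdDecidingPm, scga3DecidingPm]
  omega

/-- The score classes of the pair at the router's threshold (ScGa₃'s would-be head is the R3c straddle «UND:MIXED», BiPd's the
manifold head; both rows typed «EPH» only): PARTIAL / AGREE at θ_d = 0.350; AGREE / AGREE at any θ_d ≥ 0.359; PARTIAL / PARTIAL at
any θ_d ≤ 0.341. [folklore] -/
theorem fragile_pair_classes :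
    score (d3Word undMultiorb 350 [bipdDecidingPm]) [[eph]] = .PARTIAL ∧ score (d3Word undMixed 350 [scga3DecidingPm]) [[eph]] = .AGREE
    ∧ score (d3Word undMultiorb 359 [bipdDecidingPm]) [[eph]] = .AGREE ∧ score (d3Word undMixed 359 [scga3DecidingPm]) [[eph]] = .AGREE
    ∧ score (d3Word undMultiorb 341 [bipdDecidingPm]) [[eph]] = .PARTIAL
    ∧ score (d3Word undMixed 341 [scga3DecidingPm]) [[eph]] = .PARTIAL := by
  decide

/-! ## §7 (appended 2026-08-29T01:2xZ) The ROUTER v0.7.0 «D3-occ» gate as a second bit, and the sign of its score effect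

ROUTER v0.7.0 (director-hubbard SIGNED 2026-08-29T00:21:22Z; T₀ = 01:07:53Z) adds ONE gate in front of D3: a d site with crossing-set
count k ≥ 3 AND occupied d fraction occ_d ≥ θ_occ = 0.90 is NOT a correlated candidate (D3 silent on it). In the one-site reading of
§6 the word therefore depends on two bits — «D3 would fire on the shares» and «the gate is open (k ≥ 3 ∧ occ ≥ θ_occ)». The score
consequence has a SIGN FIXED BY THE TYPING: on an «EPH»-typed row the gate can only RAISE the cell (PARTIAL → AGREE or unchanged), on
a row typed with the d-head(s) ONLY it can only LOWER it (AGREE → DISAGREE or unchanged), and on a row typed «EPH | h+EPH» it changes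
nothing (AGREE either way). That is the by-construction content of the flip table's «21 PARTIAL→AGREE, 0 new DISAGREE» (every
triggered row was EPH-typed) and of the placement θ_occ > 0.877 (Ni metal, typed «UND:MULTIORB…» only, must stay un-gated). The 18
v8 re-word rows of 01:10Z were verified against the table cell by cell (18/18). Occupancies in thousandths in this section. -/

/-- The v0.7.0 gate on one d site: open (site NOT a candidate) iff k ≥ 3 and occ_d ≥ θ_occ. [folklore] -/
def g2Open (θocc k occ : ℕ) : Bool := decide (3 ≤ k) && decide (θocc ≤ occ)

/-- The v0.7.0 word of an «EPH»-class row in the one-site reading: if the gate is open the site is silent and the word is «EPH»;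
otherwise the v0.6.5 word `d3Word h θ shares` of §6. [folklore] -/
def g2Word (h : Head) (θocc k occ θ : ℕ) (shares : List ℕ) : List Head :=
  if g2Open θocc k occ then [eph] else d3Word h θ shares

/-- ON AN «EPH»-TYPED ROW THE GATE ONLY RAISES: the v0.7.0 cell is AGREE whenever the gate is open, and equals the v0.6.5 cell
otherwise — so it is never worse than the v0.6.5 cell (which is PARTIAL iff D3 fires, §6). [folklore] -/
theorem g2_eph_typed_only_raises (h : Head) (θocc k occ θ : ℕ) (shares : List ℕ) :
    (g2Open θocc k occ = true → score (g2Word h θocc k occ θ shares) [[eph]] = .AGREE)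
    ∧ (g2Open θocc k occ = false → score (g2Word h θocc k occ θ shares) [[eph]] = score (d3Word h θ shares) [[eph]]) := by
  refine ⟨fun hg => ?_, fun hg => ?_⟩
  · unfold g2Word; rw [if_pos hg]; decide
  · unfold g2Word; rw [hg]; rfl

/-- ON A ROW TYPED WITH THE d-HEAD ONLY («UND:MULTIORB | UND:MULTIORB+EPH», the ordered-3d control letter of Ni metal M165 / Cr
M163 / CrAs-AFM) THE GATE ONLY LOWERS: an open gate words «EPH», which carries no typed primary ⇒ DISAGREE (the no-primary floor),
while the un-gated firing word «UND:MULTIORB(…)+EPH» is AGREE. This is why θ_occ may not be ≤ 0.877: Ni metal prints occ 0.871 with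
k = 5, and gating it would manufacture a DISAGREE. [folklore] -/
theorem g2_dhead_typed_only_lowers (θocc k occ θ : ℕ) (shares : List ℕ) :
    (g2Open θocc k occ = true → score (g2Word undMultiorb θocc k occ θ shares) [[undMultiorb], [undMultiorb, eph]] = .DISAGREE)
    ∧ (d3Fires θ shares = true → g2Open θocc k occ = false →
        score (g2Word undMultiorb θocc k occ θ shares) [[undMultiorb], [undMultiorb, eph]] = .AGREE) := by
  refine ⟨fun hg => ?_, fun hf hg => ?_⟩
  · unfold g2Word; rw [if_pos hg]; decide
  · unfold g2Word d3Word; rw [hg, hf]; decide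

/-- ON A ROW TYPED «EPH | h+EPH» (the two-leg-typed rows of §5, OsB₂ / RuB₂ / LaIr₃ …) THE GATE CHANGES NOTHING: AGREE with the
gate open or shut, D3 firing or silent. [folklore] -/
theorem g2_mixed_typed_inert (h : Head) (hh : h = undMixed ∨ h = undMultiorb) (θocc k occ θ : ℕ) (shares : List ℕ) :
    score (g2Word h θocc k occ θ shares) [[eph], [h, eph]] = .AGREE := by
  unfold g2Word d3Word
  generalize g2Open θocc k occ = g; generalize d3Fires θ shares = b
  rcases hh with rfl | rfl <;> cases g <;> cases b <;> decide

/-- The placement numbers of record (ROUTER-v0.7-DRAFT §3.3, thousandths): the widest empty interval of the printed occ_d statistic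
is (877, 900) — Ni metal M165 0.871 / ZnNNi₃ 0.874 / Pt metal 0.877 / MgCNi₃ 0.877 below; PtGe 0.901 · PtH 0.903 · SrPt₃P 0.906 ·
CaPt₃P 0.909 · Pd 0.913 … above. At θ_occ = 900 with k = 5: Ni metal is NOT gated (guard holds) and PtGe IS gated by ONE thousandth —
the gate's own FRAGILE edge on Pt (lead R-qo (3): flag «FRAGILE(D3-occ: |occ − 0.90| ≤ 0.010)»), the Pd rows sit ≥ 13 thousandths
clear. [folklore] -/
theorem g2_placement_record :
    g2Open 900 5 871 = false ∧ g2Open 900 5 874 = false ∧ g2Open 900 5 877 = false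
    ∧ g2Open 900 5 901 = true ∧ g2Open 900 5 903 = true ∧ g2Open 900 5 906 = true ∧ g2Open 900 5 913 = true
    ∧ g2Open 900 1 940 = false ∧ g2Open 900 2 998 = false := by decide

/-- The cuprates are protected by the k-count, not by the occupancy: a Cu site printing occ 0.934–0.948 is un-gated at k = 1 (every
cuprate record of the flip table) but WOULD be gated at k ≥ 3 — the named failure mode pre-registered by score-2 and adopted by the
lead as a typing event + regression twin (R-qo (2)). [folklore] -/
theorem g2_cuprate_guard_is_k (occ : ℕ) (hocc : 900 ≤ occ) : g2Open 900 1 occ = false ∧ g2Open 900 3 occ = true := by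
  unfold g2Open
  constructor
  · simp
  · simp [hocc]

end RouterScore

end Summit.Ventures.CertifiedManyBodySolver.Downfold
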